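import Summits.QuantumFields.BalabanUV.T4Continuum.Support.ShellMeasureExpChartSUN
import Literature.Analysis.Calculus.ExpDuhamel

/-!
# `T4Continuum.ShellMeasureExpDuhamelSUN` — THE DUHAMEL OPERATOR OF THE EXPONENTIAL CHART OF `SU(N)` AND THE
# LEFT-TRIVIALISED DERIVATIVE OF THE CHART: `D(expPtSU)_v (h) = e^{genSU v} · genSU (T_v h)`,
# `T_X H = ∫₀¹ e^{−rX} H e^{rX} dr`
(cell `pub-balaban`, sub-cell `t4`, spine estimate NE7c (node U5b); NE7c formalisation swarm, crew seat
`b2b-balaban-t4-ne7c-formalise-leaf-08` gen 6; STEP 1 of the (CH)₁-for-`SU(N)` line of the route memo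
`HOME/b2b-balaban-t4-ne7c-formalise-leaf-09/g5/ROUTE-CH1-SUN.md` (journal l.9979; claims l.10111 (this file),
l.10254 (STEP 2, the determinant of `T_v`), l.10221 (the Hausdorff∕area-formula route (H)∕(AF))); row S3 «SM-L9 SU(N)
chart» of `t4/b2b-balaban-t4-ne7c-p1/LEAVES-NE7c-P1.md` — trigger `t4/T4-NE7c-TRIGGER.json` c5: OPTIONAL and last,
`SU(2)` is the row's certified instance; imports S3 file 1 `ShellMeasureExpChartSUN` (`genSU`, `coordSU`, `expPtSU`)
and the tree's `Literature.Analysis.Calculus.ExpDuhamel` (Duhamel's formula for `D exp` in a Banach algebra) ONLY;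
ADDITIVE, modifies nothing; 0 `def … : Prop`, 0 sorry, 0 citations — every declaration is [folklore] matrix calculus)

HONEST FRAMING.  Finite four-torus programme, rung (B)+1 only — NOT infinite volume, NOT a mass gap, NOT the Clay
problem, NOT summit progress; (B), `BetaPertHyp`, (B^μ) are not consumed.  NE7c (`T4IndicatorShell.ShellWeightBound`)
is NOT PRINTED and NOT PROVED; «NE7c ⇐ the named binders».  Nothing of [Balaban 1983–89] is read or asserted here.
This file removes NO displayed binder by itself: the one-bond chart identity (CH)₁ of
`ShellMeasureRealizedSUN.slotAntiConcentration_realized_suN_expJac` stays DISPLAYED for `N ≥ 3` until the whole line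
(this STEP 1 + STEP 2 «`det T_v = expJacSU v`» + (H)∕(AF) «Haar = normalised Hausdorff measure, area formula» + the
nullity of the non-regular cone) is in the tree.

THE OBJECTS (data `def`s — configurations and maps, not propositions; D-0009 audit lane).
* `adNeg X r H = e^{−rX} H e^{rX}` — the Duhamel integrand `Ad(e^{−rX}) H` on `M_N(ℂ)`;
* `duhamel X H = ∫ r in (0:ℝ)..1, adNeg X r H` — THE DUHAMEL OPERATOR `T_X = (1 − e^{−ad X})∕ad X` as an ELEMENT of
  `M_N(ℂ)` (Bochner interval integral in the Frobenius = Hilbert–Schmidt norm scope `Matrix.Norms.Frobenius`, the scope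
  of `T4AdjointCovarianceUnitary`'s `𝔰𝔲(N)` norm and of `T4HaarUnitaryLocalDiffeo`; the integrand has EXACTLY the
  shape of `Literature.Analysis.Calculus.ExpDuhamel.fderiv_exp_apply_eq_exp_mul_integral`), `duhamelLM`∕`duhamelL` its
  (continuous) real-linear packaging;
* `genSUₗ`∕`genSUL` — the linear chart map `E_N → M_N(ℂ)`, `v ↦ genSU v`, as a (continuous) real-linear map;
* `duhTₗ v`∕**`duhT v : ChartSU N →L[ℝ] ChartSU N`** — THE CHART OPERATOR `T_v = coordSU⁻¹ ∘ T_{genSU v} ∘ genSU`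
  (well defined because `T_X` preserves `𝔰𝔲(N)`), the map whose determinant is the Jacobian of the exponential chart.

THE THEOREMS.
* §1 `continuous_mexp`; `continuous_adNeg(_uncurry)`, `adNeg_add`∕`_smul`∕`_zero_left`; `duhamel_eq_integral` (`rfl`),
  `duhamel_add`∕`_smul`∕`_zero_left` (`T_0 = id`), `fderiv_mexp_apply` (`D exp_X (H) = e^{X} · T_X H` — `ExpDuhamel` BY
  NAME), **`hasFDerivAt_mexp`** (`HasFDerivAt exp (e^{X} · T_X) X`), `adNeg_conj_unitary`∕**`duhamel_conj_unitary`**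
  (`T_{gXg*}(gHg*) = g T_X(H) g*` for unitary `g` — `T` may be computed in any unitary frame);
* §2 `adNeg_mem_lieSU`, **`duhamel_mem_lieSU`** (`T_X` maps `𝔰𝔲(N)` into `𝔰𝔲(N)` for `X ∈ 𝔰𝔲(N)`: conjugation by the
  unitary `e^{−rX}`, `T4AdjointCovarianceUnitary.conj_mem_lieSU`, and the integral commutes with the subspace
  inclusion);
* §3 **`genSU_duhT`**∕`genSU_duhT_eq_integral` (`genSU (T_v h) = T_{genSU v}(genSU h) = ∫₀¹ e^{−r genSU v} (genSU h)
  e^{r genSU v} dr` — the characterisation by which STEP 2 (`LinearMap.det (duhT v)`) and (AF) consume `T_v`),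
  `duhT_zero` (`T_0 = id`), **`hasFDerivAt_coe_expPtSU`** (`HasFDerivAt (v ↦ ↑(expPtSU v)) (e^{genSU v} · genSU ∘ T_v)
  v` — the chain rule on `exp ∘ genSU`), `genSU_injective`,
  `injective_chartDeriv_of_injective` (the chart differential is injective as soon as `T_v` is — the hypothesis shape
  of the positive-codimension area formula);
* §4 `continuous_duhamel_genSU`, `continuous_duhT_apply`, **`continuous_duhT`** (operator-norm continuity of `v ↦ T_v`
  — finite dimension), `continuous_det_duhT` (the Jacobian `v ↦ det T_v` is continuous, hence measurable).

TYPING NOTE.  `M_N(ℂ)` carries no global norm; statements that need one (`duhamel`'s integral, `HasFDerivAt`,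
`genSUL`, `duhamelL`) are elaborated under `open scoped Matrix.Norms.Frobenius`; the rest is norm-free.  The Frobenius
topology and the global product topology of `Matrix` agree definitionally but not reducibly: bridge by `exact`∕`show`,
not by `rw` (as in `T4HaarUnitaryLocalDiffeo`).
WHAT THIS DOES NOT DO.  No determinant is computed (STEP 2); no measure identity (STEPs (H)∕(AF)); nothing about
Bałaban's minimisers or block weights; NE7c NOT proved; spine PROVED 0/9.  HONEST DEPENDENCY (cell): continuum YM on
T⁴ ⇐ BetaPertH ∧ nine spine estimates (0/9 proved); BetaPertH ⇐ (D1) ∧ (D4) ∧ CAP+tail; G-an2-4 gates asym, D1 and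
NE2/3/4.
-/

noncomputable section

open MeasureTheory Set intervalIntegral Filter
open scoped Topology

namespace Summit.QuantumFields.BalabanUV.T4Continuum.ShellMeasureExpDuhamelSUN

open Literature.MathematicalPhysics.QuantumFieldTheory.Balaban1983to89
open T4AdjointCovarianceUnitary (lieU lieSU mem_lieU_iff mem_lieSU_iff conj_mem_lieSU expSU coe_expSU
  exp_mem_unitaryGroup_of_mem_lieU)
open ShellMeasureExpChartSUN

variable {N : ℕ}

/-! ## §1 The Duhamel integrand and operator on `M_N(ℂ)` -/

/-- continuity of the matrix exponential (global topology; proved through the Frobenius norm). [folklore] -/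
theorem continuous_mexp : Continuous (NormedSpace.exp : Matrix (Fin N) (Fin N) ℂ → Matrix (Fin N) (Fin N) ℂ) := by
  open scoped Matrix.Norms.Frobenius in
  letI : NormedAlgebra ℚ (Matrix (Fin N) (Fin N) ℂ) := NormedAlgebra.restrictScalars ℚ ℝ (Matrix (Fin N) (Fin N) ℂ)
  exact NormedSpace.exp_continuous

/-- THE DUHAMEL INTEGRAND `Ad(e^{−rX}) H = e^{−rX} H e^{rX}`. [folklore] -/
def adNeg (X : Matrix (Fin N) (Fin N) ℂ) (r : ℝ) (H : Matrix (Fin N) (Fin N) ℂ) : Matrix (Fin N) (Fin N) ℂ :=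
  NormedSpace.exp (-(r • X)) * H * NormedSpace.exp (r • X)

/-- joint continuity of the integrand in `(X, H, r)`. [folklore] -/
theorem continuous_adNeg_uncurry :
    Continuous fun q : (Matrix (Fin N) (Fin N) ℂ × Matrix (Fin N) (Fin N) ℂ) × ℝ => adNeg q.1.1 q.2 q.1.2 := by
  have hs : Continuous fun q : (Matrix (Fin N) (Fin N) ℂ × Matrix (Fin N) (Fin N) ℂ) × ℝ => q.2 • q.1.1 :=
    continuous_snd.smul (continuous_fst.comp continuous_fst)
  have h1 : Continuous fun q : (Matrix (Fin N) (Fin N) ℂ × Matrix (Fin N) (Fin N) ℂ) × ℝ =>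
      NormedSpace.exp (-(q.2 • q.1.1)) := continuous_mexp.comp hs.neg
  have h2 : Continuous fun q : (Matrix (Fin N) (Fin N) ℂ × Matrix (Fin N) (Fin N) ℂ) × ℝ =>
      NormedSpace.exp (q.2 • q.1.1) := continuous_mexp.comp hs
  have h3 : Continuous fun q : (Matrix (Fin N) (Fin N) ℂ × Matrix (Fin N) (Fin N) ℂ) × ℝ => q.1.2 :=
    continuous_snd.comp continuous_fst
  unfold adNeg
  exact (h1.mul h3).mul h2

/-- continuity of the integrand in `r`. [folklore] -/
theorem continuous_adNeg (X H : Matrix (Fin N) (Fin N) ℂ) : Continuous fun r : ℝ => adNeg X r H := by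
  have hs : Continuous fun r : ℝ => r • X := continuous_id.smul continuous_const
  have h1 : Continuous fun r : ℝ => NormedSpace.exp (-(r • X)) := continuous_mexp.comp hs.neg
  have h2 : Continuous fun r : ℝ => NormedSpace.exp (r • X) := continuous_mexp.comp hs
  unfold adNeg
  exact (h1.mul continuous_const).mul h2

/-- at `X = 0` the integrand is `H`. [folklore] -/
theorem adNeg_zero_left (r : ℝ) (H : Matrix (Fin N) (Fin N) ℂ) : adNeg 0 r H = H := by
  simp [adNeg]

/-- additivity in `H`. [folklore] -/
theorem adNeg_add (X : Matrix (Fin N) (Fin N) ℂ) (r : ℝ) (H₁ H₂ : Matrix (Fin N) (Fin N) ℂ) :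
    adNeg X r (H₁ + H₂) = adNeg X r H₁ + adNeg X r H₂ := by
  simp only [adNeg, mul_add, add_mul]

/-- real homogeneity in `H`. [folklore] -/
theorem adNeg_smul (X : Matrix (Fin N) (Fin N) ℂ) (r c : ℝ) (H : Matrix (Fin N) (Fin N) ℂ) :
    adNeg X r (c • H) = c • adNeg X r H := by
  simp only [adNeg, mul_smul_comm, smul_mul_assoc]

section Frob

open scoped Matrix.Norms.Frobenius

/-- THE DUHAMEL OPERATOR `T_X H = ∫₀¹ e^{−rX} H e^{rX} dr` (Bochner interval integral in the Frobenius = Hilbert–Schmidt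
norm scope of `M_N(ℂ)`; for matrices `T_X = (1 − e^{−ad X})/ad X`). An element of `M_N(ℂ)`, linear in `H`. [folklore] -/
def duhamel (X H : Matrix (Fin N) (Fin N) ℂ) : Matrix (Fin N) (Fin N) ℂ := ∫ r in (0:ℝ)..1, adNeg X r H

/-- `duhamel` unfolded to the integrand shape of `Literature.Analysis.Calculus.ExpDuhamel`. [folklore] -/
theorem duhamel_eq_integral (X H : Matrix (Fin N) (Fin N) ℂ) :
    duhamel X H = ∫ r in (0:ℝ)..1, NormedSpace.exp (-(r • X)) * H * NormedSpace.exp (r • X) := rfl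

/-- additivity of the Duhamel operator. [folklore] -/
theorem duhamel_add (X H₁ H₂ : Matrix (Fin N) (Fin N) ℂ) : duhamel X (H₁ + H₂) = duhamel X H₁ + duhamel X H₂ := by
  unfold duhamel
  rw [← intervalIntegral.integral_add ((continuous_adNeg X H₁).intervalIntegrable 0 1)
    ((continuous_adNeg X H₂).intervalIntegrable 0 1)]
  congr 1
  funext r
  exact adNeg_add X r H₁ H₂

/-- real homogeneity of the Duhamel operator. [folklore] -/
theorem duhamel_smul (X : Matrix (Fin N) (Fin N) ℂ) (c : ℝ) (H : Matrix (Fin N) (Fin N) ℂ) :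
    duhamel X (c • H) = c • duhamel X H := by
  unfold duhamel
  rw [← intervalIntegral.integral_smul]
  congr 1
  funext r
  exact adNeg_smul X r c H

/-- `T_0 = id`. [folklore] -/
theorem duhamel_zero_left (H : Matrix (Fin N) (Fin N) ℂ) : duhamel 0 H = H := by
  unfold duhamel
  simp [adNeg_zero_left]

/-- THE DUHAMEL OPERATOR AS A REAL-LINEAR MAP of `M_N(ℂ)`. [folklore] -/
def duhamelLM (X : Matrix (Fin N) (Fin N) ℂ) : Matrix (Fin N) (Fin N) ℂ →ₗ[ℝ] Matrix (Fin N) (Fin N) ℂ where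
  toFun := duhamel X
  map_add' := duhamel_add X
  map_smul' := duhamel_smul X

/-- THE DUHAMEL OPERATOR AS A CONTINUOUS REAL-LINEAR MAP (finite dimension; Frobenius scope). [folklore] -/
def duhamelL (X : Matrix (Fin N) (Fin N) ℂ) := LinearMap.toContinuousLinearMap (duhamelLM X)

/-- `duhamelL X H = duhamel X H`. [folklore] -/
@[simp] theorem duhamelL_apply (X H : Matrix (Fin N) (Fin N) ℂ) : duhamelL X H = duhamel X H := rfl

/-- **THE DERIVATIVE OF THE MATRIX EXPONENTIAL, LEFT-TRIVIALISED** (Duhamel ∕ Poincaré):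
`D exp_X (H) = e^{X} · T_X H` — `Literature.Analysis.Calculus.ExpDuhamel.fderiv_exp_apply_eq_exp_mul_integral` BY NAME.
[folklore] -/
theorem fderiv_mexp_apply (X H : Matrix (Fin N) (Fin N) ℂ) :
    fderiv ℝ NormedSpace.exp X H = NormedSpace.exp X * duhamel X H := by
  letI : NormedAlgebra ℚ (Matrix (Fin N) (Fin N) ℂ) := NormedAlgebra.restrictScalars ℚ ℝ (Matrix (Fin N) (Fin N) ℂ)
  exact Literature.Analysis.Calculus.fderiv_exp_apply_eq_exp_mul_integral X H

/-- **`HasFDerivAt exp (H ↦ e^{X} · T_X H) X`** on `M_N(ℂ)` (Frobenius scope). [folklore] -/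
theorem hasFDerivAt_mexp (X : Matrix (Fin N) (Fin N) ℂ) :
    HasFDerivAt (NormedSpace.exp : Matrix (Fin N) (Fin N) ℂ → Matrix (Fin N) (Fin N) ℂ)
      ((ContinuousLinearMap.mul ℝ (Matrix (Fin N) (Fin N) ℂ) (NormedSpace.exp X)).comp (duhamelL X)) X := by
  letI : NormedAlgebra ℚ (Matrix (Fin N) (Fin N) ℂ) := NormedAlgebra.restrictScalars ℚ ℝ (Matrix (Fin N) (Fin N) ℂ)
  have h := Literature.Analysis.Calculus.hasFDerivAt_exp_fderiv (𝔸 := Matrix (Fin N) (Fin N) ℂ) X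
  refine h.congr_fderiv ?_
  ext1 H
  exact fderiv_mexp_apply X H

/-- the integrand is conjugation-covariant: `Ad(e^{−r gXg*})(gHg*) = g · Ad(e^{−rX})H · g*` for unitary `g`
(`T4AdjointCovarianceUnitary.exp_conj_unitary`). [folklore] -/
theorem adNeg_conj_unitary {g : Matrix (Fin N) (Fin N) ℂ} (hg : g ∈ Matrix.unitaryGroup (Fin N) ℂ)
    (X H : Matrix (Fin N) (Fin N) ℂ) (r : ℝ) :
    adNeg (g * X * star g) r (g * H * star g) = g * adNeg X r H * star g := by
  have hsg : star g * g = 1 := T4AdjointCovarianceUnitary.star_coe_mul_coe ⟨g, hg⟩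
  have hneg : -(r • (g * X * star g)) = g * (-(r • X)) * star g := by
    rw [Matrix.mul_neg, Matrix.neg_mul, Matrix.mul_smul, Matrix.smul_mul]
  have hpos : r • (g * X * star g) = g * (r • X) * star g := by
    rw [Matrix.mul_smul, Matrix.smul_mul]
  unfold adNeg
  rw [hneg, hpos, T4AdjointCovarianceUnitary.exp_conj_unitary ⟨g, hg⟩,
    T4AdjointCovarianceUnitary.exp_conj_unitary ⟨g, hg⟩]
  -- `(g A g*)(g H g*)(g B g*) = g (A H B) g*`
  calc g * NormedSpace.exp (-(r • X)) * star g * (g * H * star g) * (g * NormedSpace.exp (r • X) * star g)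
      = g * NormedSpace.exp (-(r • X)) * (star g * g) * H * (star g * g) * NormedSpace.exp (r • X) * star g := by
          noncomm_ring
    _ = g * (NormedSpace.exp (-(r • X)) * H * NormedSpace.exp (r • X)) * star g := by
          rw [hsg]; noncomm_ring

/-- **CONJUGATION COVARIANCE OF THE DUHAMEL OPERATOR**: `T_{gXg*}(gHg*) = g · T_X H · g*` for unitary `g` — the
operator may be computed in any unitary frame (the input of the determinant computation, STEP 2). [folklore] -/
theorem duhamel_conj_unitary {g : Matrix (Fin N) (Fin N) ℂ} (hg : g ∈ Matrix.unitaryGroup (Fin N) ℂ)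
    (X H : Matrix (Fin N) (Fin N) ℂ) :
    duhamel (g * X * star g) (g * H * star g) = g * duhamel X H * star g := by
  have hfun : (fun r : ℝ => adNeg (g * X * star g) r (g * H * star g)) =
      fun r => ContinuousLinearMap.mulLeftRight ℝ (Matrix (Fin N) (Fin N) ℂ) g (star g) (adNeg X r H) := by
    funext r
    rw [adNeg_conj_unitary hg]
    rfl
  unfold duhamel
  rw [hfun, ContinuousLinearMap.intervalIntegral_comp_comm _ ((continuous_adNeg X H).intervalIntegrable 0 1)]
  rfl

/-! ## §2 The Duhamel operator preserves `𝔰𝔲(N)` -/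

/-- each value of the integrand lies in `𝔰𝔲(N)` when `X, H ∈ 𝔰𝔲(N)` (conjugation by the unitary `e^{−rX}`,
`T4AdjointCovarianceUnitary.conj_mem_lieSU`). [folklore] -/
theorem adNeg_mem_lieSU {X H : Matrix (Fin N) (Fin N) ℂ} (hX : X ∈ lieSU (Fin N)) (hH : H ∈ lieSU (Fin N)) (r : ℝ) :
    adNeg X r H ∈ lieSU (Fin N) := by
  have hrX : -(r • X) ∈ lieSU (Fin N) := (lieSU (Fin N)).neg_mem ((lieSU (Fin N)).smul_mem r hX)
  have hrU : -(r • X) ∈ lieU (Fin N) := mem_lieU_iff.2 (mem_lieSU_iff.1 hrX).1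
  have hstar : star (NormedSpace.exp (-(r • X)) : Matrix (Fin N) (Fin N) ℂ) = NormedSpace.exp (r • X) := by
    rw [NormedSpace.star_exp, star_neg, star_smul, (mem_lieSU_iff.1 hX).1]
    simp
  have h := conj_mem_lieSU hH ⟨NormedSpace.exp (-(r • X)), exp_mem_unitaryGroup_of_mem_lieU hrU⟩
  unfold adNeg
  rwa [hstar] at h

/-- **`T_X` MAPS `𝔰𝔲(N)` INTO `𝔰𝔲(N)`** (the integrand stays in the closed subspace `𝔰𝔲(N)`; the Bochner integral
commutes with the subspace inclusion). [folklore] -/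
theorem duhamel_mem_lieSU {X H : Matrix (Fin N) (Fin N) ℂ} (hX : X ∈ lieSU (Fin N)) (hH : H ∈ lieSU (Fin N)) :
    duhamel X H ∈ lieSU (Fin N) := by
  let g : ℝ → lieSU (Fin N) := fun r => ⟨_, adNeg_mem_lieSU hX hH r⟩
  have hg : Continuous g := (continuous_adNeg X H).subtype_mk _
  have hcomm := ((lieSU (Fin N)).subtypeL).intervalIntegral_comp_comm (hg.intervalIntegrable (μ := volume) 0 1)
  have hval : duhamel X H = ((∫ r in (0:ℝ)..1, g r : lieSU (Fin N)) : Matrix (Fin N) (Fin N) ℂ) := hcomm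
  rw [hval]
  exact Submodule.coe_mem _


/-! ## §3 The chart operator on `E_N = ChartSU N` and the derivative of the exponential chart -/

/-- real homogeneity of the generator (the tree's `genSU_smul` with the real scalar kept real). [folklore] -/
theorem genSU_smul_real (c : ℝ) (v : ChartSU N) : genSU (c • v) = c • genSU v := by
  unfold genSU
  rw [map_smul]
  rfl

/-- the generator of a chart point lies in `𝔰𝔲(N)`. [folklore] -/
theorem genSU_mem_lieSU (v : ChartSU N) : genSU v ∈ lieSU (Fin N) := (coordSU v).2

/-- THE LINEAR CHART MAP `E_N → M_N(ℂ)`, `v ↦ genSU v`, as a real-linear map. [folklore] -/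
def genSUₗ : ChartSU N →ₗ[ℝ] Matrix (Fin N) (Fin N) ℂ :=
  (lieSU (Fin N)).subtype ∘ₗ ((coordSU (N := N)).toLinearEquiv : ChartSU N →ₗ[ℝ] lieSU (Fin N))

/-- `genSUₗ v = genSU v`. [folklore] -/
@[simp] theorem genSUₗ_apply (v : ChartSU N) : genSUₗ v = genSU v := rfl

/-- THE LINEAR CHART MAP AS A CONTINUOUS LINEAR MAP (finite dimension; Frobenius scope on the target). [folklore] -/
def genSUL := LinearMap.toContinuousLinearMap (genSUₗ (N := N))

/-- `genSUL v = genSU v`. [folklore] -/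
@[simp] theorem genSUL_apply (v : ChartSU N) : genSUL v = genSU v := rfl

/-- THE CHART OPERATOR `T_v` of the exponential chart of `SU(N)` as a real-linear map of the chart space `E_N`:
`T_v h = coordSU⁻¹ (T_{genSU v} (genSU h))` — the Duhamel operator of the generator, read back in the orthonormal
coordinates (it preserves `𝔰𝔲(N)`, `duhamel_mem_lieSU`). [folklore] -/
def duhTₗ (v : ChartSU N) : ChartSU N →ₗ[ℝ] ChartSU N where
  toFun h := (coordSU (N := N)).symm
    ⟨duhamel (genSU v) (genSU h), duhamel_mem_lieSU (genSU_mem_lieSU v) (genSU_mem_lieSU h)⟩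
  map_add' h₁ h₂ := by
    rw [← map_add]
    congr 1
    apply Subtype.ext
    simp only [Submodule.coe_add, genSU_add, duhamel_add]
  map_smul' c h := by
    rw [RingHom.id_apply, ← map_smul]
    congr 1
    apply Subtype.ext
    simp only [Submodule.coe_smul, genSU_smul_real, duhamel_smul]

/-- **THE CHART OPERATOR `T_v : E_N →L[ℝ] E_N`** (the object whose determinant is the Jacobian of the exponential
chart). [folklore] -/
def duhT (v : ChartSU N) : ChartSU N →L[ℝ] ChartSU N := LinearMap.toContinuousLinearMap (duhTₗ v)

/-- **`genSU (T_v h) = T_{genSU v} (genSU h)`** — the chart operator IS the Duhamel operator of the generator in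
coordinates. [folklore] -/
theorem genSU_duhT (v h : ChartSU N) : genSU (duhT v h) = duhamel (genSU v) (genSU h) := by
  show ((coordSU ((coordSU (N := N)).symm _) : lieSU (Fin N)) : Matrix (Fin N) (Fin N) ℂ) = _
  rw [LinearIsometryEquiv.apply_symm_apply]

/-- the same with the integral displayed: `genSU (T_v h) = ∫₀¹ e^{−r·genSU v} (genSU h) e^{r·genSU v} dr` — the
characterisation by which the determinant file (STEP 2) and the area-formula file (AF) consume `T_v`. [folklore] -/
theorem genSU_duhT_eq_integral (v h : ChartSU N) :
    genSU (duhT v h) =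
      ∫ r in (0:ℝ)..1, NormedSpace.exp (-(r • genSU v)) * genSU h * NormedSpace.exp (r • genSU v) :=
  genSU_duhT v h

/-- `T_0 = id`. [folklore] -/
theorem duhT_zero : duhT (0 : ChartSU N) = ContinuousLinearMap.id ℝ (ChartSU N) := by
  ext1 h
  apply (coordSU (N := N)).injective
  apply Subtype.ext
  show genSU (duhT 0 h) = genSU h
  rw [genSU_duhT, genSU_zero, duhamel_zero_left]

/-- **THE DERIVATIVE OF THE EXPONENTIAL CHART, LEFT-TRIVIALISED**: at every chart point `v`,
`D(v ↦ expPtSU v)(h) = expPtSU v · genSU (T_v h)` — i.e. `HasFDerivAt (v ↦ ↑(expPtSU v)) (e^{genSU v} · genSU ∘ T_v) v`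
as an `M_N(ℂ)`-valued map (Frobenius scope).  STEP 1 of the (CH)₁ line for `SU(N)`; the chain rule on
`exp ∘ genSU` with `hasFDerivAt_mexp`. [folklore] -/
theorem hasFDerivAt_coe_expPtSU (v : ChartSU N) :
    HasFDerivAt (fun w : ChartSU N => ((expPtSU w : SUN N) : Matrix (Fin N) (Fin N) ℂ))
      ((ContinuousLinearMap.mul ℝ (Matrix (Fin N) (Fin N) ℂ) (NormedSpace.exp (genSU v))).comp
        (genSUL.comp (duhT v))) v := by
  have h1 : HasFDerivAt (fun w : ChartSU N => NormedSpace.exp (genSUL w))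
      (((ContinuousLinearMap.mul ℝ (Matrix (Fin N) (Fin N) ℂ) (NormedSpace.exp (genSUL v))).comp
        (duhamelL (genSUL v))).comp genSUL) v :=
    (hasFDerivAt_mexp (genSUL v)).comp v (genSUL (N := N)).hasFDerivAt
  refine h1.congr_fderiv ?_
  ext1 h
  show NormedSpace.exp (genSU v) * duhamel (genSU v) (genSU h) = NormedSpace.exp (genSU v) * genSU (duhT v h)
  rw [genSU_duhT]

/-- the linear chart map is injective (`coordSU` is an isometry onto `𝔰𝔲(N) ⊆ M_N(ℂ)`). [folklore] -/
theorem genSU_injective : Function.Injective (genSU (N := N)) :=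
  Subtype.val_injective.comp (coordSU (N := N)).injective

/-- **THE CHART DIFFERENTIAL IS INJECTIVE AS SOON AS `T_v` IS**: `e^{genSU v}` is a unit and `genSU` is injective, so
`h ↦ e^{genSU v} · genSU (T_v h)` is injective iff `T_v` is — the hypothesis shape of the positive-codimension area
formula (`Function.Injective (f' x)`), to be fed by `0 < det T_v` (STEP 2). [folklore] -/
theorem injective_chartDeriv_of_injective {v : ChartSU N} (hT : Function.Injective (duhT v)) :
    Function.Injective
      ((ContinuousLinearMap.mul ℝ (Matrix (Fin N) (Fin N) ℂ) (NormedSpace.exp (genSU v))).comp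
        (genSUL.comp (duhT v))) := by
  intro h₁ h₂ h12
  have h12' : NormedSpace.exp (genSU v) * genSU (duhT v h₁) = NormedSpace.exp (genSU v) * genSU (duhT v h₂) := h12
  letI : NormedAlgebra ℚ (Matrix (Fin N) (Fin N) ℂ) := NormedAlgebra.restrictScalars ℚ ℝ (Matrix (Fin N) (Fin N) ℂ)
  have hunit : IsUnit (NormedSpace.exp (genSU v) : Matrix (Fin N) (Fin N) ℂ) := NormedSpace.isUnit_exp _
  obtain ⟨u, hu⟩ := hunit
  rw [← hu] at h12'
  exact hT (genSU_injective ((Units.mul_right_inj u).1 h12'))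

/-! ## §4 Continuity of the chart operator in the chart point -/

/-- joint continuity `(v, r) ↦ Ad(e^{−r·genSU v})(genSU h)`. [folklore] -/
theorem continuous_adNeg_genSU_uncurry (h : ChartSU N) :
    Continuous (Function.uncurry fun (v : ChartSU N) (r : ℝ) => adNeg (genSU v) r (genSU h)) := by
  have hs : Continuous fun q : ChartSU N × ℝ => q.2 • genSU q.1 :=
    continuous_snd.smul (continuous_genSU.comp continuous_fst)
  have h1 : Continuous fun q : ChartSU N × ℝ => NormedSpace.exp (-(q.2 • genSU q.1)) :=
    continuous_mexp.comp hs.neg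
  have h2 : Continuous fun q : ChartSU N × ℝ => NormedSpace.exp (q.2 • genSU q.1) := continuous_mexp.comp hs
  show Continuous fun q : ChartSU N × ℝ =>
    NormedSpace.exp (-(q.2 • genSU q.1)) * genSU h * NormedSpace.exp (q.2 • genSU q.1)
  exact (h1.mul continuous_const).mul h2

/-- continuity of `v ↦ T_{genSU v}(genSU h)` (a parametric interval integral with jointly continuous integrand).
[folklore] -/
theorem continuous_duhamel_genSU (h : ChartSU N) :
    Continuous fun v : ChartSU N => duhamel (genSU v) (genSU h) := by
  have hc := intervalIntegral.continuous_parametric_intervalIntegral_of_continuous' (μ := volume)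
    (f := fun (v : ChartSU N) (r : ℝ) => adNeg (genSU v) r (genSU h)) (continuous_adNeg_genSU_uncurry h) 0 1
  unfold duhamel
  exact hc

/-- pointwise continuity of the chart operator: `v ↦ T_v h` is continuous. [folklore] -/
theorem continuous_duhT_apply (h : ChartSU N) : Continuous fun v : ChartSU N => duhT v h := by
  have hc : Continuous fun v : ChartSU N =>
      (⟨duhamel (genSU v) (genSU h), duhamel_mem_lieSU (genSU_mem_lieSU v) (genSU_mem_lieSU h)⟩ :
        lieSU (Fin N)) :=
    (continuous_duhamel_genSU h).subtype_mk _
  exact (coordSU (N := N)).symm.continuous.comp hc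

/-- **CONTINUITY OF THE CHART OPERATOR** `v ↦ T_v` in operator norm (finite dimension: pointwise continuity
suffices, `continuous_clm_apply`). [folklore] -/
theorem continuous_duhT : Continuous (duhT : ChartSU N → ChartSU N →L[ℝ] ChartSU N) :=
  continuous_clm_apply.2 continuous_duhT_apply

/-- hence the Jacobian `v ↦ det T_v` is continuous (so measurable) on the chart space. [folklore] -/
theorem continuous_det_duhT : Continuous fun v : ChartSU N => (duhT v).det :=
  ContinuousLinearMap.continuous_det.comp continuous_duhT

end Frob

end Summit.QuantumFields.BalabanUV.T4Continuum.ShellMeasureExpDuhamelSUN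

end
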